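import Summits.HodgeConjecture.HodgeConjecture.Theorems.F0P6aPELWitnessEDefs            -- ED. 5 (M-L): the DEFINITIONS LAYER (`GSAdele`, `IsCMTypeThrough`, `mOf`, `AuxChartGS`, `PELWitnessE`, `SigDatum`, `RecordSignatureDatumOfSystem`) — same namespace, FQNs unchanged
import Literature.AlgebraicGeometry.ShimuraVarieties.UnitaryShimuraCurveRecordSignatureDatum          -- ★ «L5» LA5-p01∕p02 (g0) p848252 `RecordSystemGS.exists_sigDatum` (organs ★ p847754 p847725 p847937 p848039): PAYS `stub_SIG` IN-LINE (ED. 5, LEAD «M-64» (4)); the L5 leaf `Lines/F0_P6a_StubSIG.lean` (imports (D)) is its served sorry-free twin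
import Literature.AlgebraicGeometry.ModuliOfAbelianVarieties.SiegelUniversalFamilyUniformisationHolds  -- ★ p849986 `siegelUniversalFamilyUniformisation_holds` (the L7 leaf՚s substance behind the gate; the ★ twin cannot import `Lines/F0_P6a_StubUNIVFAM` — NO-CROSS-IMPORT); was:              -- L7 CLOSER LEAF (LA7-plan (g0); organs ★ p847727 p847835 p847935 p847965 p847957 p848159 p848424 p848162 p848386): `StubUNIVFAM.stub_UNIVFAM_closed` — CLOSES `stub_UNIVFAM` BY NAME modulo the leaf's printed residue `stub_RELEXP` = ★ P-1 `relativeExponentialUniformisation` (ED. 5 β)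
import Summits.HodgeConjecture.HodgeConjecture.Theorems.F0P6aStubE6                   -- L6 CLOSER LEAF (A-p06 (g34) over the Σ-GAL leaf `Lines/F0_P6a_SigmaGAL.lean` (A-p04 (g24), `stub_KCM` paid by LA6-p01) + ★ Σ-AN p848496 `readsCReading_of_junction`): `F0P6aStubE6.stub_E6_of_line` — CLOSES `stub_E6` BY NAME (sorry-free)
import Literature.AlgebraicGeometry.ShimuraVarieties.UnitaryCurveSiegelBorel                      -- ★ E4 p846949 `RecordSystemGS.exists_hom_of_holomorphicSiegelLifts` (`stub_E4` PAID, ED. 2)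
import Literature.AlgebraicGeometry.ShimuraVarieties.UnitaryCurveSiegelDescent                    -- ★ E5 `RecordSystemGS.exists_sliceDescent_of_complex` (`stub_E5` PAID, ED. 2)
import Literature.AlgebraicGeometry.ShimuraVarieties.UnitaryCurveSiegelChartMoverClassifiedJunction -- ★ A-p04 p847567 (J1) junction constructor (ED. 5: field `junction`)
import Literature.AlgebraicGeometry.ShimuraVarieties.UnitaryCurveSiegelTowerSeparation              -- ★ A-p01 p847628 Deligne 1.15 organ: the Siegel shadow separates at deep `b`-saturated levels (ED. 5: `f_injective`)
import Literature.AlgebraicGeometry.ShimuraVarieties.UnitaryCurveSiegelDescentSeparation            -- ★ A-p15 p847435 `algPoints_map_injective_of_sliceDescent` (ED. 5: `PELWitnessE.sep`)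
import Literature.AlgebraicGeometry.ShimuraVarieties.UnitaryCurveAuxiliaryChartActionReading          -- ★ E1 FILE 9 `exists_chartActionReading_frame` (ED. 3; ED. 5 field `Mρ_frame`)
import Literature.AlgebraicGeometry.ShimuraVarieties.UnitaryCurveAuxiliaryPeriodEquivariantField      -- ★ A-p17 (g27) (M-eq) `exists_siegelLevelGroup_lattice_transport_comm_reading` (ED. 4)
import Literature.AlgebraicGeometry.ShimuraVarieties.UnitaryCurveAuxiliaryKottwitzField               -- ★ A-p17 (g27) (K) `exists_linear_comm_siegelPeriodMap_charpoly_eq_prod_pow` (ED. 4)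
import Literature.AlgebraicGeometry.ShimuraVarieties.UnitaryCurveAuxiliaryIntegralActionV             -- ★ E1 7b `exists_symplecticFrameV_integralAction` (ED. 4)
import Literature.AlgebraicGeometry.ShimuraVarieties.UnitaryCurveAuxiliaryLevelContainmentV            -- ★ E1 FILE 6 neat level `Kc ⊓ inl⁻¹ K_V(3)` (ED. 4)
import Literature.AlgebraicGeometry.ShimuraVarieties.UnitaryCurveAuxiliaryComplexStructureInjective   -- ★ E2 A5 `auxComplexStructureV_hJinj` (ED. 4)
import Literature.AlgebraicGeometry.ShimuraVarieties.UnitaryCurveAuxiliarySymplecticRationalPointsV   -- ★ E1 `hbrat_auxToGspFinV` (ED. 4)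
import Literature.AlgebraicGeometry.ShimuraVarieties.UnitaryCurveAuxiliarySymplecticLevelV            -- ★ E1 `continuous_auxToGspFinV` (ED. 4)
import Literature.NumberTheory.NumberFields.GaloisEnvelopeInsideComplex                              -- ★ A-p01 p847415 `exists_isGalois_envelope` (the slice field `Fᵢ₀`, ED. 4)
import Summits.HodgeConjecture.HodgeConjecture.Theorems.F0P6aSpecialPairRecipOfChart                  -- ★ A-p09 (g22) p847064 `exists_sliceField_f_recip` (`f_recip` glue, ED. 4)
import Summits.HodgeConjecture.HodgeConjecture.Theorems.F0P6aSpecialPairRecipDatumOfChart             -- ★ LA6-p01∕p02 (g0) p847777 + ED. 2 `exists_sliceField_f_recip_cmDatum_pinned` (ED. 5: fields `cm_recip` + `f_recip`)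
import Summits.HodgeConjecture.HodgeConjecture.Theorems.HCCMUnconditionalSiegelDebtClosers            -- ★ (U) `siegelModuli_complexUniformisation_holds` PROVED (ED. 4)
import Summits.HodgeConjecture.HodgeConjecture.Theorems.HCCMUnconditionalSiegelFineModuliDebtCloser   -- ★ (F) `lan2013_siegelFineModuliScheme_holds` PROVED (ED. 4)

/-!
# `F0P6aPELWitnessE` — ★ RE-HOME (rung-0 re-homing task, books INVENTORY §8.4 M-3; LEAD F0P6-plan (g4) «M-72») of the crux workfile `Lines/F0_P6a_PELWitnessE.lean`

This `Theorems/` module is the TREE BYTES of `Summits/HodgeConjecture/HodgeConjecture/Cruxes/HLiu418/Lines/F0_P6a_PELWitnessE.lean` (edition of record,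
tree sha16 4cba526fb67849a3, 519 l., code-`sorry`-free) with the NAMESPACE KEPT — `Summit.HodgeConjecture.HodgeConjecture.Cruxes.HLiu418.F0P6aPELWitnessE` — so that every
fully-qualified name (``AuxChartGS``, `stub_SIG`, `conjTranspose_map_id_of_transpose_map_complexConj`, `stub_E123`, `stub_E4`, `stub_E5`, `stub_E6`, `stub_UNIVFAM`, `pelWitnessE_of_line`; 9 declarations) is UNCHANGED; only this module
docstring is re-headed and the `Lines` imports are switched to their ★ re-homed twins (`F0_P6a_PELWitnessEDefs` → `Theorems.F0P6aPELWitnessEDefs`, `F0_P6a_StubE6` → `Theorems.F0P6aStubE6`).  Why a re-home: a `Theorems/` file cannot import a `Lines/` workfile (F0P6-ref1 o-6), and closing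
stmt-HodgeConjecture-24832 `--as proved --by <Theorems decl>` at rung 0 needs the sorry-free Lines chain behind the gate (RE-HOME MAP v1.1, LA7-plan (g4),
2026-09-02; director g27 s1336 (R1)–(R3)).    Lines importers of the original: `F0_P6a_PELInputs`, `F0_P6a_StubKOTT`.
After this file is ★ the Lines workfile is meant to become a one-import SHIM of it (a `Lines/` write, batched per cone on the LEAD's word), so no
environment ever holds two copies (NO-CROSS-IMPORT rule, «M-72» (3)).  It asserts nothing beyond what the workfile already proves.

## Original module docstring (verbatim)
# `F0_P6a_PELWitnessE` — LINE (E) «EMBEDDING DOOR» for the generic witness of `stub_RGD` (LEAD F0P6-plan (g2) RULING M-17m′, 2026-09-01T21:14:54Z)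

CRUX `stmt-HodgeConjecture-24832` (HLiu418), sub-line P6a, socket `stub_RGD : RecordModuliDatumCofinal` (main `Lines/F0_P6a_ModuliDatum.lean` ED. 3 :569).
GEN heir A-p18 (g31); scoping memo `F0/P6/A-p18/g31/SCOPING-U1-U2.v1.A-p18g31.md` da0494744d2f064b §3 (door (E)), §1 (the socket S1–S8).
HC_CM is proved only modulo the 2 remaining named inputs (hLiu418 24832, h413 24833) until rung 0 closes; this workfile asserts nothing
beyond its registered `sorry` stubs.

WHY THIS LINE.  `RecordModuliDatumCofinal` lets GEN choose the PEL tuple `univ act dual pol g N lvl` AFTER the place `w`, over the localised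
spread `𝓨` of the THICKENED RECORD CURVE `(S.M Kc) ⊗_F Fᵢ`.  Door (E): the generic object is that curve ITSELF — `X := (S.M Kc) ⊗_F Fᵢ`,
`φ = 𝟙` — and the tuple is the PULL-BACK of the universal triple of the ★ ℚ-Siegel fine moduli scheme `𝓜 : SiegelFineModuliScheme g N δ`
(★ `lan2013_siegelFineModuliScheme`, PROVED in `Theorems/HCCMUnconditionalSiegelDebtClosers`) along a SLICE MORPHISM `ε : X ⟶ 𝓜.M ⊗_ℚ Fᵢ`,
the rank-2 twin of the cell՚s ★ hDel I-1′ road (`UnitaryAuxiliary*`, `SiegelBorelExtension*`) and of ★ u2 (`UnitaryShimuraCurveEmbedding{Complex,Descent,Holds}`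
— complex half by GAGA piece-wise over the record՚s own `pieces`∕`hol`, descent half by [Milne2005ShimuraVarieties] Prop. 13.1 + the record՚s `recip` +
Siegel ★ reciprocity, FOR EVERY record `S`).  Then (S1) smooth of rel. dim 1, projective, (S2) `pts`, (S3) `pieces`, (S4) `recip` of the scoping memo
are THE RECORD՚S OWN FIELDS (★ UNIQ `exists_iso_baseChange_weakModel_natural` is not needed), and the price is `ε` + the `𝒪_F`-action.

ARCHITECTURE (ED. 1).  E1 (aux symplectic module), E2 (complex structure `J_Φ(v)`, period matrix `Z(v, a)`) and E3 (the point map) are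
DEFINITION organs; a stub cannot be stated by value over definitions that do not exist yet.  Hence their joint OUTPUT is ONE interface
structure `AuxChartGS` (§2; fields by value in ★ currency ONLY — Siegel target + chosen (U) witnesses `Sc ιc unif`, point map `f`, per adelic
`a` a piece index and a PERIOD FUNCTION `Z a : (Fin 2 → ℂ) → Matrix (Fin g) (Fin g) ℂ` with `Z_hol`∕`Z_mem`∕`f_mk` = the rank-2
`HasHolomorphicSiegelLift` shape, `f_injective`, the CM RECIPROCITY COMPATIBILITY `f_recip` (E5՚s input), the Siegel FIBRE ADMISSIBILITY
`f_admissible` ((U3∃) at the image point), and the LATTICE READING `Mρ a : 𝓞 F →+* M_{2g}(ℤ)` with `Mρ_kottwitz` (period-linearity + Kottwitz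
signature `mOf ι₁ Φ` on `ℂ^g`) and `Mρ_rosati` (adjointness for `typeForm δ`)), and the stubs are:
* `stub_E123` — for every letter context, slice field `Fᵢ ⊆ ℂ` (`τE ∘ algebraMap = ι₁`) and CM type `Φ ∋ ι₁`: `∃` chart (E1+E2+E3 hands; organs
  `ShimuraVarieties/UnitaryCurveAuxiliarySymplecticModule` (A-p01), `…PeriodMap`∕`…ComplexStructure` (E2 mints), `…SiegelPointMap`);
* `stub_E4` — GAGA∕Borel on the compact DISC pieces: a `ℂ`-morphism `ψ : (S.M Kc) ⊗_{ι₁} ℂ ⟶ 𝓜.M ⊗_ℚ ℂ` inducing `f` (rank-1 twin of ★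
  `SiegelBorelExtensionPiece.exists_hom_of_holomorphicSiegelLift` over ★ `UnitaryShimuraCurveEmbeddingComplex`՚s piece glue);
* `stub_E5` — DESCENT: `ψ` over `ℂ` + `f_recip` ⇒ `ε : (S.M Kc) ⊗_F Fᵢ ⟶ 𝓜.M ⊗_ℚ Fᵢ` inducing `f` (pattern ★ `RecordSystemGS.embeddingDefinedOver_of_complex`);
* `stub_E6` — TUPLE + ACTION: `P := ε^* 𝓜.univ` (★ `PolarizedAbelianSchemeWithLevel.IsBaseChangeVia`) and `ρ : RingAction (𝓞 F) P.A` with ROSATI and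
  KOTTWITZ AT `ℂ`-POINTS of signature `mOf ι₁ Φ` (★ `AbelianVariety.cotangentMap` ∘ ★ `fibreHom`) — the ONE genuinely new M–L organ (GAGA + rigidity
  descent, or the finite-étale-section road; census by the E6 hand A-p06 (g31)).
HEAD `pelWitnessE_of_line` composes them into `Nonempty (PELWitnessE …)` = the scoping memo՚s socket (S5)(S6)(S7 at ℂ-points); (S7) at `Ω`-points and
the SPREAD to `𝓨` are GEN glue inside `stub_RGD` ((U1-c) ★-to-be `KottwitzConditionClosed` on the reduced `X`: a closed locus containing every
`ℂ`-valued point is everything).  ED. 2 (booked): the MARKING READING «`ρ_x(b)` is `Mρ a b` under the (U3∃) marking at `f [v, aKc]`» and the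
lattice reading `Λ_a ⊂ F²` ((U4) HECKE roofs, `twistIdeal`, (C1)), as extra fields of `AuxChartGS`∕`PELWitnessE`; no ED. 1 TYPE changes.

EDITION 2 («M-23», GEN heir A-p18 (g31)): `AuxChartGS` RE-TYPED TO THE ★ ORGANS THAT NOW EXIST — its Siegel side and point-map block are the OUTPUT
of ★ E3 FILE C `UnitaryCurve.exists_siegelChartGS` TOKEN FOR TOKEN (adds `unif_cont∕unif_open∕unif_surj∕unif_iff`, `irreducible`, principal representatives
`u rep` with their five (U3) premisses, the Shimura-set bijection `pts` and the SHADOW laws `f_pts`∕`f_rep`∕`pts_unif`, and the CLASSIFICATION `f_classifies`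
(U3-D3)), and it now CARRIES THE HODGE-EMBEDDING DATUM `(J, hJ, hJneg, hJsmul, b, bq, hb, hJrat, hJinj, hbrat, hbcont, hle, hZ)` as fields (E1 FILE 5 + E2
outputs; the INPUTS of FILE C and of ★ tower separation `UnitaryCurve.eq_of_forall_siegelPointMap_eq`); `f_injective` is DROPPED (LEAD (G2): false at a general
finite level — separation is a THEOREM of the datum, finite-level injectivity comes from Deligne stationarity with RGD՚s freedom in `Kc`, run by GEN at assembly;
the `PELWitnessE` injectivity slot (S8) follows in ED. 3 with the tower bookkeeping); `stub_E4` is PAID by ★ E4 p846949 through the new field `unif_cont`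
(A-p14 (g33) TIE cca6250f) and `stub_E5` is PAID by ★ E5 `RecordSystemGS.exists_sliceDescent_of_complex` (A-p15 (g18) junction 6e0fd62b); the chart
moreover carries the RATIONAL MOVERS `q a ∈ GSp_δ(ℚ)` with their law `q_spec` (★ E3 FILE D `UnitaryCurve.exists_siegelChartGS_mover`, clause (Q): `Z a` is
E2՚s period function in the frame `(q a)_ℝ⁻¹`, and `(q a)_𝔸 · rep (piece a) K_δ(N) = b(a) K_δ(N)` — the input of the (M) block ★ `exists_chartActionReading_kottwitz`
∕ ★ `SiegelIntegralReadingConjugation`: `Mρ a = (q a)⁻¹ ρ (q a)`), and the (M-eq) law `Z_equivariant` (period equivariance under the arithmetic level with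
`Mρ`-commuting INTEGRAL monodromy — E6 owner A-p06 (g32) MEMO 07c2eec7 §1 VERBATIM; supplied by ★ A-p17 (g27) `UnitaryCurveAuxiliaryPeriodLevelTransport`);
the PRINTED LETTER of the door-(E) road of record is P-3 «UNIV-FAMILY» (★ named fact `siegelUniversalFamilyUniformisation`, [Lange2023AbelianVarietiesComplex]
§3.4 ∕ [MumfordFogartyKirwan1994] App. 7A), entering as the tree-local `sorry` `stub_UNIVFAM` consumed IN-LINE by `stub_E6`՚s closer (LEAD g2 22:51:15Z ∕
M-17m⁗; U6-a `relativeExponentialUniformisation` is off-road capital and is NOT stubbed here); `stub_E6`՚s TYPE is unchanged.  Shape (α′) «neat-below» (owner rulings 23:59:37Z ∕ 00:00:44Z, LEAD «M-45»):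
`stub_E123` and the head conclude `∃ Kc' ≤ Kc, ∀ Kc'' ≤ Kc', ∃ Fi₀ …, …` (the chart ∕ PEL tuple at EVERY small level below a neat one, the slice field chosen per
level — no fine level-`N ≥ 3` family exists at a level containing `−1`).
Tree-local sorries after
ED. 2∕ED. 3 = {`stub_SIG`, `stub_E123`, `stub_E6`, `stub_UNIVFAM`}, ALL FOUR in the cone BY NAME of `pelWitnessE_of_line`; **ED. 4 (A-p01 (g26)): `stub_E123` is PAID**
— its body is the by-name assembly E1 (★ 7b frame + lattice reading, ★ FILE 6 neat level) → (F)+(U) PROVED (★ `lan2013_siegelFineModuliScheme_holds`,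
★ `siegelModuli_complexUniformisation_holds`) → E2∕E3 (★ `exists_siegelChartGS_auxComplexStructureV_mover_classified_of_sigDatum`: Deligne's `J_Φ′` at
`Φ′ := flip ι₁ (bar Φ)`, positivity from the `SigDatum` for `t • J⋆` by ★ `UnitaryCurveAuxiliaryFormRescaling`) → (M) ★ FILE 9 + ★ (K) + ★ (M-eq) → (R) ★
`exists_sliceField_f_recip` over the Galois envelope ★ `exists_isGalois_envelope` of its slice field — so the tree-local sorries after ED. 4 are
{`stub_SIG`, `stub_E6`, `stub_UNIVFAM`} (names of all four kept) (ref1 (g3) o-16 cure (T):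
`stub_E123` takes `(hsig : SigDatum F ι₁ Jstar)` fed by `stub_SIG`, `stub_E6` takes `(hU : siegelUniversalFamilyUniformisation)` fed by `stub_UNIVFAM`) (`stub_SIG : RecordSignatureDatumOfSystem` = LEAD heir «M-42» (a): the POSITIVITY GAP of the signature-free P6 letters localised as ONE named stub) (co-pen A-p01 (g26) under LEAD heir F0P6-plan (g3) M-34; owner of record GEN heir A-p18 (g31)).

EDITION 5 («M-52» «N-PARAMETRIC + SEP AT SATURATED LEVEL», E-pen A-p01 (g27); LEAD list 01:18:35Z; design memo `MEMO-ELineED5-design.v1.A-p01g27.md`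
VARIANT M «minimal ripple»): NO structure is re-parameterised.  `AuxChartGS` gains `ρ₀`∕`Mρ_frame` ((M-fr), A-p15 (g18): the lattice readings are rational
conjugates `(q a)⁻¹ ρ₀ (q a)` of ONE frame reading — PAID by clause (fr) of ★ `exists_chartActionReading_frame`), `bq_comm_ρ₀` ((D-lin), A-p15 (g19) 02:32:26Z,
LA6-r01 #0b ∕ LAref-E L6 #2 GREEN: the rational Hodge embedding commutes with the frame reading — PAID by ★ `UnitaryCurve.AuxV.map_intCast_reading_mul_coe_auxRepV_comm`
(LA6-p02 (g0), E1 FILE 7b part 2) at `R := ℚ`), `junction` ((J1), the full (U3) junction on every piece, PAID by the constructor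
★ `exists_siegelChartGS_auxComplexStructureV_mover_classified_junction_of_sigDatum`, A-p04 (g24) p847567) and `f_injective` (PAID: Deligne՚s Prop. 1.15 AT
PRINCIPAL LEVEL ★ `UnitaryCurve.exists_forall_le_siegelShadow_separates` p847628 — Noetherian image-stationarity ★ `ComplexPointsImageStationarity` + tower
separation ★ `UnitaryCurveSiegelPointSeparation` + the free action of `GSp_δ(ℚ) ∩ xK_δ(N)x⁻¹` ★ `SiegelRationalStabiliserTrivial` — read through ★
`injective_of_shadow_formula` over `f_pts`) and `cm_recip` ((R+), «L6» LA6-p01 (g0): the CM datum BY VALUE at the special points, PAID by ★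
`exists_sliceField_f_recip_cmDatum` p847777, of which `f_recip` is the corollary); `PELWitnessE` gains the PROVENANCE `(𝓜, ε, G, Ĝ, isBaseChange)` of `stub_E6`՚s pull-back and **`sep`** (`ε` injective on
complex points: ★ `RecordSystemGS.algPoints_map_injective_of_sliceDescent` p847435 over `C.f_injective`; the P-line՚s `Ω̄_w`-form `ESepAt` is its transport ★
`Motives.algPoints_map_injective_of_injective_algPoints` p847641).  `stub_E123` (PAID) and the HEAD are re-shaped: ONE Hodge-embedding `b` per `Kc` (continuous,
`b(Kc) ⊆ K_δ(1)` — the integrality conjunct of ★ 7b `exists_symplecticFrameV_integralAction`, so that every `Kc ⊓ b⁻¹K_δ(N)` is a small level NORMAL in `Kc`) and a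
depth `k₀`, and the chart ∕ the witness at EVERY level `Kc'' = Kc ⊓ b⁻¹K_δ(3(k+1)!)`, `k ≥ k₀` (the tuple level `N = 3(k+1)!` is read off the chart; GEN puts the primes
`≤ k+1` into `S_M`).  (α′)՚s «every `Kc'' ≤ Kc'`» is withdrawn: injectivity holds at the saturated levels only (LEAD «M-52» (i)).  `stub_E4`∕`stub_E5`∕`stub_E6`∕
`stub_SIG`∕`stub_UNIVFAM` TYPES UNCHANGED; `stub_SIG` PAID in-line (line «L5», ★ p848252) and `stub_UNIVFAM` CLOSED BY NAME by the L7 leaf (modulo its printed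
residue `stub_RELEXP` = ★ P-1) and `stub_E6` CLOSED BY NAME by the L6 leaf `Lines/F0_P6a_StubE6.lean` (sorry-free over the Σ-GAL leaf + ★ Σ-AN);
tree-local sorries of THIS FILE: NONE (its only non-TRIO axiom is `sorryAx` ← L7՚s printed `stub_RELEXP`).  LAYOUT β (LEAD «M-63»): the definitions live in `Lines/F0_P6a_PELWitnessEDefs.lean`
(same namespace, FQNs unchanged); closer leaves import that layer and this file imports the leaves.

WHY IT MIGHT FAIL (as typed).  (i) `f_recip` asks the SIEGEL-side Galois action `(σ.restrictScalars ℚ) • f [ι₁w, a]` to follow the UNITARY reciprocity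
factor `d` (`c(s)∕s` on `w`, `1` on `w^⊥`): true only when `σ` fixes the slice field `Fᵢ ⊇` reflex(Φ)·(field of the aux class) — the statement binds
`σ : ℂ ≃ₐ[Fᵢ] ℂ` and lets E3 choose `Fᵢ` large (finitely many CM types ⇒ one `Fᵢ` for all frames); if even so a central character survives, E3 answers
«stub-misstated» with the corrected twist and the chart grows a field (rank-3 precedent: ★ `UnitaryAuxiliaryReflexTransport`).  (ii) `Mρ_rosati`
orientation (`ᵀ` on the conjugate side) is PROVISIONAL — the W-junction pins it; a flip is a token edit of one field.  (iii) `stub_E6` without the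
ED. 2 marking clause leaves `ρ` pinned only by ring law + Rosati + Kottwitz signature — enough for (S5)–(S7), not for (U4).
[cite: RapoportSmithlingZhang2020Diagonal, §3.2, Lemma 3.4–Prop. 3.7 pp. 12–14, §4.1 p. 17] [cite: Deligne1971TravauxShimura, 4.11–4.12 p. 148, 4.16 p. 150]
[cite: Milne2005ShimuraVarieties, Thm. 6.11 p. 74, Prop. 13.1 p. 117, Thm. 13.7 p. 119, Prop. 14.12 p. 125] [cite: Borel1972ExtensionTheorem, Thm. 3.10 p. 559]
[cite: Kottwitz1992, §5 pp. 389–391] [cite: Shimura1998, §18.6 Main Theorem 1]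
-/

set_option autoImplicit false

noncomputable section

namespace Summit.HodgeConjecture.HodgeConjecture.Cruxes.HLiu418.F0P6aPELWitnessE

set_option linter.dupNamespace false  -- `Summit.HodgeConjecture.HodgeConjecture.…` BY DESIGN (D-0017)

open CategoryTheory CategoryTheory.Limits NumberField IsDedekindDomain MulAction Matrix AlgebraicGeometry
open scoped Matrix ComplexOrder Polynomial
open Literature.AlgebraicGeometry.Motives (SchemeOver AlgPoints ComplexPoints specOver)
open Literature.AlgebraicGeometry.Motives.AbelianVariety (bcSpec)
open Literature.AlgebraicGeometry.AbelianSchemes (PolarizedAbelianSchemeWithLevel AbelianSchemeOver)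
open Literature.AlgebraicGeometry.ModuliOfAbelianVarieties
open Literature.AlgebraicGeometry.ShimuraVarieties Literature.AlgebraicGeometry.ShimuraVarieties.UnitaryCanonicalModel
open Literature.AlgebraicGeometry.HodgeTheory (IsQuasiProjectiveOver)
open Literature.NumberTheory.Automorphic Literature.NumberTheory.Automorphic.UnitaryGroup
open Literature.NumberTheory.Automorphic.Liu2021.AppendixC (C5.OpenCompactSubgroup C5.SmallLevel C5.HeckeLE)

/-! ### §0 The registered stubs (bodies `sorry`; heads BY VALUE) -/

/-- **`stub_SIG` — THE SIGNATURE DATUM OF THE RECORD SYSTEM** (NEW in ED. 2, «M-42» (a); **PAID in ED. 5 by line «L5»** — ★ `RecordSystemGS.exists_sigDatum`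
(LA5-p01∕p02 (g0) p848252 over ★ `UnitaryShimuraCurveRecordSignature` p847754 (cases (1)(2): positivity off `ι₁` from the record՚s ball data), ★ `UnitaryShimuraCurveRecordDiscrete`
p847725 + ★ `UnitaryGroupEllipticGeneratorBounded` p847937 + ★ `UnitaryGroupTwoIndefinitePlacesNotDiscrete` p848039 (case (3): a record system with two indefinite
places would have a non-discrete arithmetic level — the transcendental obstruction below, now PROVED in-house); the L5 closer leaf `Lines/F0_P6a_StubSIG.lean`
(`F0P6aStubSIG.stub_SIG_of_line`, imports the Defs layer) is the served sorry-free twin of this payment; registered name and statement kept): consumed by `stub_E123`՚s closure (`obtain ⟨t, …⟩ := stub_SIG …`,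
then the E-door run at `H := t • J⋆`, `U(t•J⋆) = U(J⋆)`).  ITS REAL CONTENT (SIG-AUDIT «M-42» (b), verdict of record F0P6-ref1 (g3) 23:38:42Z ∕ LEAD heir
23:39:39Z: VACUOUS IN TRUTH, NOT PROVABLY VACUOUS IN-HOUSE): with `L₁ := ℚ(J⋆ᵢⱼ) ⊆ F` and `σ` off the place of `ι₁` — case (2) `σ|_{L₁} ∉ {ι₁|_{L₁}, ῑ₁|_{L₁}}`:
`hpos σ` IS derivable from the record՚s ball data (`(B q).posDef_of_ne` after extending `σ ∘ ι₁⁻¹` by `IsAlgClosed.lift`, ≈ 60 l., a by-product of A-p17՚s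
★ `UnitarySignatureDatum`); case (3) `σ|_{L₁} ∈ {ι₁, ῑ₁}|_{L₁}` but `mk σ ≠ mk ι₁` (possible iff `ℚ(J⋆ᵢⱼ) ⊉ F⁺`): then `(t•J⋆)^σ` has signature `(1,1)` and the
only obstruction to such a record system is transcendental (an irreducible lattice in `U(1,1)^{≥2} ×` compact has non-discrete `ι₁`-projection — Raghunathan
Cor. 5.21-class, XL, not in the tree) — THIS is what the stub asserts.  Exit E2 of record (LEAD + ref1 recommendation, after tonight՚s train, human-grade):
registry reshape `stub_D9opSig : CorD9OnMOpSig` forwarding the distilled binder `hdef` through the P6 letters, which DELETES this stub with zero new mathematics.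
[cite: Liu2021, App. C §C.1 p. 107 ((p_τ, q_τ)); Rem. C.2 p. 108 (signature (n−1,1) at τ, (n,0) elsewhere)]
[cite: RapoportSmithlingZhang2020Diagonal, §3.1 p. 8 (signatures of W at the archimedean places); cf. Rem. 3.6 (ii) p. 13] -/
theorem stub_SIG : RecordSignatureDatumOfSystem :=
  fun _F _ _ _ _ _ι₁ _Jstar hJ _hJu _K₀ S Kc => RecordSystemGS.exists_sigDatum S Kc hJ


section StubE123Paid

open scoped TensorProduct
open Literature.AlgebraicGeometry.Motives (CMType)
open Literature.AlgebraicGeometry.ModuliOfAbelianVarieties.SiegelModuli (C0 jOfSiegel jOfSiegel_mem_C0)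
open Literature.AlgebraicGeometry.ShimuraVarieties.UnitaryCanonicalModel.Aux (ratBasis torusFinAdelic)
open Literature.AlgebraicGeometry.ShimuraVarieties.UnitaryCurve Literature.AlgebraicGeometry.ShimuraVarieties.UnitaryCurve.AuxV
open Literature.NumberTheory.ComplexMultiplication.CMTypeOps (flip bar mem_flip_bar_self)
open Literature.NumberTheory.NumberFields (exists_isGalois_envelope)
open Summit.HodgeConjecture.HodgeConjecture.Theorems.F0P6aSpecialPairRecipOfChart (exists_sliceField_f_recip)
open Summit.HodgeConjecture.HodgeConjecture.Theorems.F0P6aSpecialPairRecipDatumOfChart (exists_sliceField_f_recip_cmDatum_pinned)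
open Summit.HodgeConjecture.HodgeConjecture.Theorems.HCCMUnconditionalSiegelDebtClosers (siegelModuli_complexUniformisation_holds)
open Summit.HodgeConjecture.HodgeConjecture.Theorems.HCCMUnconditionalSiegelFineModuliDebtCloser (lan2013_siegelFineModuliScheme_holds)

/-- `ᵗc(J⋆) = J⋆` read as hermitian-ness of `J⋆^{id}` (the `hH` binder of ★ E1 at the curve `M = L = F`, `j = id`; ED. 4).
[cite: RapoportSmithlingZhang2020Diagonal, §3.1 p. 8] -/
theorem conjTranspose_map_id_of_transpose_map_complexConj {F : Type} [Field F] [NumberField F] [IsCMField F]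
    {Jstar : Matrix (Fin 2) (Fin 2) F} (hJ : (Jstar.map (IsCMField.complexConj F))ᵀ = Jstar) :
    (Jstar.map (RingHom.id F))ᴴ = Jstar.map (RingHom.id F) := by
  have hid : Jstar.map (RingHom.id F) = Jstar := by
    ext i j
    rfl
  rw [hid]
  conv_rhs => rw [← hJ]
  rfl

/-- **`stub_E123` (PAID; ED. 5 «N-PARAMETRIC + SEP AT SATURATED LEVEL», LEAD «M-52»: the chart, now with `junction` and `f_injective`, EXISTS AT EVERY SUFFICIENTLY DEEP
`b`-SATURATED LEVEL `Kc ⊓ b⁻¹K_δ(3(k+1)!)`, `k ≥ k₀`, of ONE Hodge-embedding `b` per `Kc` — ★ `UnitaryCurve.exists_forall_le_siegelShadow_separates` p847628 feeds `f_injective`;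
ED. 4 text follows) — EXISTENCE OF THE AUXILIARY SIEGEL CHART AT A DEEPER SMALL LEVEL `Kc' ≤ Kc`** (E1 aux symplectic module + E2 period map + E3 point map;
ED. 2 THREADS the signature datum `hsig : SigDatum F ι₁ Jstar` — ref1 (g3) o-16 cure (T) — and, shape (α) (owner ruling 23:59:37Z on A-p01՚s finding):
the chart lives at EVERY small level `Kc'' ≤ Kc'` BELOW SOME NEAT `Kc' ≤ Kc` (shape (α′) «neat-below», GEN 00:00:44Z: the slice
field `Fi₀` is chosen per level `Kc''`, INSIDE the `∀ Kc''`), not at `Kc` itself — at a level containing `−1` no `N ≥ 3` Siegel level receives `b(−1) = −1`, so door (E)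
supplies no fine PEL family there; the E1 closer takes `Kc' := Kc ⊓ b⁻¹K_δ(3)` (★ FILE 6 §2) or deeper, and `RecordPELInputsCofinal` gives GEN that freedom): for every letter
context and every CM type `Φ ∋ ι₁` there is a SLICE FIELD `Fᵢ₀ ∕ F` (finite Galois, with a complex embedding `τ₀` extending `ι₁`; in print: the
compositum of the reflex field of `Φ` and the field of definition of the auxiliary class — [RapoportSmithlingZhang2020Diagonal] (3.10)) such that over
EVERY slice field `Fᵢ ⊇ Fᵢ₀` (an `F`-embedding `j` with `τE ∘ j = τ₀`) there is an `AuxChartGS` (GEN takes for `Fᵢ` the compositum over the finitely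
many frames `Φ`; RGD lets it choose `Fᵢ`; in print the auxiliary-type chart lives over `E = φ₀(F)·E_Φ`, Remark 3.1, «`E` may be larger» than `F`).
[cite: Deligne1979ShimuraVarieties, 2.3.10] [cite: RapoportSmithlingZhang2020Diagonal, Remark 3.1 p. 9, §3.2 and Lemma 3.4–Prop. 3.7 pp. 11–14]
[cite: Milne2005ShimuraVarieties, Thm. 6.11 p. 74] -/
theorem stub_E123 : ∀ (F : Type) [Field F] [NumberField F] [IsCMField F] [IsGalois ℚ F] (ι₁ : F →+* ℂ)
    (Jstar : Matrix (Fin 2) (Fin 2) F) (_hJ : (Jstar.map (IsCMField.complexConj F))ᵀ = Jstar) (_hJu : IsUnit Jstar)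
    (K₀ : C5.OpenCompactSubgroup (GSAdele F Jstar)) (S : RecordSystemGS F Jstar ι₁ K₀) (Kc : C5.SmallLevel K₀)
    (Φ : Set (F →+* ℂ)) (_hΦ : IsCMTypeThrough ι₁ Φ) (_hsig : SigDatum F ι₁ Jstar),
    ∃ (g : ℕ) (δ : Fin g → ℕ) (b : GSAdele F Jstar →* ↥(gspFinAdelic δ)) (k₀ : ℕ),
      Continuous b ∧ Kc.1.1 ≤ (principalLevelSubgroup δ 1).comap b ∧
      ∀ k : ℕ, k₀ ≤ k → ∀ (Kc'' : C5.SmallLevel K₀),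
        Kc''.1.1 = Kc.1.1 ⊓ (principalLevelSubgroup δ (3 * (k + 1).factorial)).comap b →
    ∃ (Fi₀ : Type) (_ : Field Fi₀) (_ : NumberField Fi₀) (_ : Algebra F Fi₀) (_ : IsGalois F Fi₀) (τ₀ : Fi₀ →+* ℂ),
      τ₀.comp (algebraMap F Fi₀) = ι₁ ∧
      ∀ (Fi : Type) [Field Fi] [NumberField Fi] [Algebra F Fi] [IsGalois F Fi] (τE : Fi →+* ℂ) (j : Fi₀ →ₐ[F] Fi),
        τE.comp (j : Fi₀ →+* Fi) = τ₀ → Nonempty (AuxChartGS F ι₁ Jstar K₀ S Kc'' Fi τE Φ) := by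
  intro F _ _ _ _ ι₁ Jstar hJ hJu K₀ S Kc Φ hΦ hsig
  classical
  -- §0 the signature datum and the E2 CM type `Φ' = flip ι₁ (bar Φ)`
  obtain ⟨t, hτt, hτt', ⟨T, hT⟩, hpos⟩ := hsig
  set Φ' : CMType F := flip ι₁ (bar (⟨Φ, hΦ.2⟩ : CMType F)) with hΦ'
  have hΦ'm : ι₁ ∈ Φ'.1 := mem_flip_bar_self (⟨Φ, hΦ.2⟩ : CMType F) hΦ.1
  -- §1 E1: the skew scalar, the integral symplectic frame and the lattice reading of `𝒪_F` (★ 7b) — ONE FRAME PER `Kc` (ED. 5)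
  obtain ⟨ξ, hξ0, hξc, -, hξk⟩ := exists_xi_of_sigDatum Φ' hτt hτt'
  have hbot : IsCompact ((⊥ : Subgroup ↥(torusFinAdelic F)) : Set ↥(torusFinAdelic F)) := by
    rw [Subgroup.coe_bot]
    exact isCompact_singleton
  obtain ⟨k, g, δ, Fr, ρ, hk, hg, hδ, hint, hρ⟩ :=
    exists_symplecticFrameV_integralAction (RingHom.id F) Jstar ξ (conjTranspose_map_id_of_transpose_map_complexConj hJ) hJu hξ0 hξc
      Kc.1.1 ⊥ Kc.1.2.2 hbot
  have hξ' : ∀ ρ' : Φ'.1, (ρ'.1 (((k : ℚ) • ξ) * t⁻¹)).im < 0 := hξk k hk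
  -- the Hodge-embedding datum of the frame (N-free): `b = ũ_V ∘ inl`, continuous, with `b(Kc) ⊆ K_δ(1)` (the integrality conjunct of ★ 7b)
  have hbcont : Continuous ((auxToGspFinV Fr).comp (MonoidHom.inl _ ↥(torusFinAdelic F))) :=
    (continuous_auxToGspFinV Fr).comp (continuous_id.prodMk continuous_const)
  have hb1 : Kc.1.1 ≤ (principalLevelSubgroup δ 1).comap ((auxToGspFinV Fr).comp (MonoidHom.inl _ ↥(torusFinAdelic F))) :=
    fun a ha => hint (Subgroup.mem_prod.2 ⟨ha, Subgroup.one_mem _⟩)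
  -- §2 the neat level `K₃ := Kc ⊓ b⁻¹K_δ(3)` (★ FILE 6 §2) and DELIGNE 1.15 AT PRINCIPAL LEVEL along the tower `Kc ⊓ b⁻¹K_δ(3(k+1)!)` (★ A-p01 p847628)
  have hK'o := isOpen_inf_comap_inl_auxLevelV Fr (N := 3) (by norm_num) Kc.1.1 Kc.1.2.1
  have hK'c := isCompact_inf_comap_inl_auxLevelV Fr (N := 3) (by norm_num) Kc.1.1 Kc.1.2.2
  obtain ⟨K₃, hK₃⟩ : ∃ K₃ : C5.SmallLevel K₀, K₃.1.1 = Kc.1.1 ⊓ (auxLevelV Fr 3).comap (MonoidHom.inl _ ↥(torusFinAdelic F)) :=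
    ⟨⟨⟨Kc.1.1 ⊓ (auxLevelV Fr 3).comap (MonoidHom.inl _ ↥(torusFinAdelic F)), hK'o, hK'c⟩,
      le_trans (inf_le_left : Kc.1.1 ⊓ (auxLevelV Fr 3).comap (MonoidHom.inl _ ↥(torusFinAdelic F)) ≤ Kc.1.1) Kc.2⟩, rfl⟩
  have hle₃ : K₃.1.1 ≤ (principalLevelSubgroup δ 3).comap ((auxToGspFinV Fr).comp (MonoidHom.inl _ _)) := by
    rw [hK₃]; exact (inf_comap_inl_auxLevelV_le Fr 3 Kc.1.1).2
  obtain ⟨k₀, hk₀⟩ := exists_forall_le_siegelShadow_separates S (auxComplexStructureV Fr ι₁ Φ')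
    (auxComplexStructureV_mem_C0pm_of_sigDatum Fr Φ' hΦ'm hJ hτt hτt' hξ' T hT hpos)
    ((auxToGspFinV Fr).comp (MonoidHom.inl _ _)) ((auxToGspRatV Fr).comp (MonoidHom.inl _ _))
    lan2013_siegelFineModuliScheme_holds siegelModuli_complexUniformisation_holds hg hδ
    (neg_auxComplexStructureV_mem_C0_of_sigDatum Fr Φ' hΦ'm hJ hτt hτt' hξ' T hT hpos)
    (fun c hc v _ => auxComplexStructureV_smul Fr ι₁ Φ' v hc) (hb_auxToGspFinV_inl Fr)
    (auxComplexStructureV_hJrat Fr ι₁ Φ' (negCone (Jstar.map ι₁))) (auxComplexStructureV_hJinj Fr ι₁ Φ' (isExtAdapted_id_of_mem Φ' hΦ'm))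
    (fun γ x h => hbrat_auxToGspFinV Fr γ x h) hbcont (fun γ _ hC => periodChartV F Fr Φ' ι₁ hδ.1 γ hC) (le_refl 3) K₃ hle₃
  refine ⟨g, δ, (auxToGspFinV Fr).comp (MonoidHom.inl _ _), k₀, hbcont, hb1, fun kk hkk Kc'' hKc'' => ?_⟩
  -- the level `N = 3(kk+1)! ≥ 3` and the saturated source level `Kc'' = Kc ⊓ b⁻¹K_δ(N) = K₃ ⊓ b⁻¹K_δ(N)`
  have hN : 3 ≤ 3 * (kk + 1).factorial := Nat.le_mul_of_pos_right 3 (Nat.factorial_pos _)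
  have hle : Kc''.1.1 ≤ (principalLevelSubgroup δ (3 * (kk + 1).factorial)).comap ((auxToGspFinV Fr).comp (MonoidHom.inl _ _)) := by
    rw [hKc'']; exact inf_le_right
  have hK₃le : K₃.1.1 ⊓ (principalLevelSubgroup δ (3 * (kk + 1).factorial)).comap ((auxToGspFinV Fr).comp (MonoidHom.inl _ _)) ≤ Kc''.1.1 := by
    rw [hKc'', hK₃]
    exact fun x hx => ⟨hx.1.1, hx.2⟩
  -- separation of `Sh_{Kc''}` by the level-`N` Siegel shadow (Deligne 1.15, conjunct (ii) of ★ p847628 moved up to `Kc''`)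
  have hsep : ∀ (v v' : Fin 2 → ℂ) (hv : v ∈ negCone (Jstar.map ι₁)) (hv' : v' ∈ negCone (Jstar.map ι₁)) (a a' : GSAdele F Jstar),
      SiegelShimuraSet.mk δ (principalLevelSubgroup δ (3 * (kk + 1).factorial))
          ⟨auxComplexStructureV Fr ι₁ Φ' v, auxComplexStructureV_mem_C0pm_of_sigDatum Fr Φ' hΦ'm hJ hτt hτt' hξ' T hT hpos v hv⟩
          (((auxToGspFinV Fr).comp (MonoidHom.inl _ _)) a) =
        SiegelShimuraSet.mk δ (principalLevelSubgroup δ (3 * (kk + 1).factorial))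
          ⟨auxComplexStructureV Fr ι₁ Φ' v', auxComplexStructureV_mem_C0pm_of_sigDatum Fr Φ' hΦ'm hJ hτt hτt' hξ' T hT hpos v' hv'⟩
          (((auxToGspFinV Fr).comp (MonoidHom.inl _ _)) a') →
      ShimuraSetGS.mk F Jstar ι₁ Kc''.1.1 v hv a = ShimuraSetGS.mk F Jstar ι₁ Kc''.1.1 v' hv' a' :=
    fun v v' hv hv' a a' h => ShimuraSetGS.mk_eq_mk_of_le F Jstar ι₁ hK₃le ((hk₀ kk hkk).1 v v' hv hv' a a' h)
  -- §3 the Siegel target (F) and the uniformisation fact (U), both PROVED in the cell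
  obtain ⟨𝓜, hsmooth, hqp, -⟩ := lan2013_siegelFineModuliScheme_holds g (3 * (kk + 1).factorial) δ hg hδ hN
  -- §4 the chart with movers, carrier classification and (J) junction at `J_{Φ'}`, positivity from the signature datum
  obtain ⟨Sc, ιc, unif, f, piece, Z, u, rep, pts, q, hcol, hirr, hcont, hopen, hsurj, hiff, hhol, hrep, hZd, hZm, hfmk, hptsf,
      hmkrep, hval, hadm, hQ, hD3, hJunc⟩ :=
    exists_siegelChartGS_auxComplexStructureV_mover_classified_junction_of_sigDatum siegelModuli_complexUniformisation_holds hg hδ hN 𝓜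
      Φ' hΦ'm Fr hJ hτt hτt' hξ' T hT hpos Kc''.1.1 hle
  -- (P+) the point map is injective (★ `injective_of_shadow_formula` over `f_pts`)
  have hfinj : Function.Injective f :=
    injective_of_shadow_formula (auxComplexStructureV Fr ι₁ Φ') (auxComplexStructureV_mem_C0pm_of_sigDatum Fr Φ' hΦ'm hJ hτt hτt' hξ' T hT hpos)
      ((auxToGspFinV Fr).comp (MonoidHom.inl _ _)) Kc''.1.1 hsep f
      (fun y => pts (AlgPoints.baseChangeEquiv (algebraMap ℚ ℂ) 𝓜.M y)) hptsf
  -- §5 the (M) block: the conjugated lattice reading (★ FILE 9)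
  obtain ⟨Mρ, hR, hNρ, -, -, hfr⟩ := exists_chartActionReading_frame F Fr Φ' ι₁ hδ.1 ρ hρ rep (fun c => (hrep c).2.2.1) piece Z q hZm hQ
  -- §6 reciprocity (E3R glue) and the Galois envelope of its slice field
  obtain ⟨E₀, hfd, hι₁E₀, hrec⟩ := exists_sliceField_f_recip_cmDatum_pinned hg hδ hN 𝓜 ιc unif (fun c => (hrep c).1) (fun c => (hrep c).2.1)
    (fun c => (hrep c).2.2.2.1) hD3 pts hval ι₁ Jstar hJ Φ' hΦ'm Fr
    (auxComplexStructureV_mem_C0pm_of_sigDatum Fr Φ' hΦ'm hJ hτt hτt' hξ' T hT hpos) ρ hρ Kc''.1.1 f hptsf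
  obtain ⟨Fi₀, hF₀, hN₀, hA₀, hG₀, τ₀, hτ₀, hcov₀⟩ := exists_isGalois_envelope ι₁ E₀ hfd hι₁E₀
  refine ⟨Fi₀, hF₀, hN₀, hA₀, hG₀, τ₀, hτ₀, fun Fi _ _ _ _ τE jF hj => ?_⟩
  have hcov : ∀ x : ℂ, x ∈ E₀ → ∃ y : Fi, τE y = x := fun x hx => by
    obtain ⟨y₀, rfl⟩ := hcov₀ x hx
    exact ⟨jF y₀, by rw [← hj]; rfl⟩
  -- §7 assemble the chart
  refine ⟨{
      g := g
      N := 3 * (kk + 1).factorial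
      δ := δ
      hg := hg
      g_eq := Fr.eq_finrank_of_two
      hδ := hδ
      hN := hN
      𝓜 := 𝓜
      smooth_M := hsmooth
      quasiProjective_M := hqp
      J := auxComplexStructureV Fr ι₁ Φ'
      hJ := auxComplexStructureV_mem_C0pm_of_sigDatum Fr Φ' hΦ'm hJ hτt hτt' hξ' T hT hpos
      hJneg := neg_auxComplexStructureV_mem_C0_of_sigDatum Fr Φ' hΦ'm hJ hτt hτt' hξ' T hT hpos
      hJsmul := fun c hc v _ => auxComplexStructureV_smul Fr ι₁ Φ' v hc
      b := (auxToGspFinV Fr).comp (MonoidHom.inl _ _)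
      bq := (auxToGspRatV Fr).comp (MonoidHom.inl _ _)
      hb := hb_auxToGspFinV_inl Fr
      hJrat := auxComplexStructureV_hJrat Fr ι₁ Φ' (negCone (Jstar.map ι₁))
      hJinj := auxComplexStructureV_hJinj Fr ι₁ Φ' (isExtAdapted_id_of_mem Φ' hΦ'm)
      hbrat := fun γ x h => hbrat_auxToGspFinV Fr γ x h
      hbcont := (continuous_auxToGspFinV Fr).comp (continuous_id.prodMk continuous_const)
      hle := hle
      hZ := fun γ _ hC => periodChartV F Fr Φ' ι₁ hδ.1 γ hC
      Sc := Sc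
      ιc := ιc
      unif := unif
      isColimit_ιc := hcol
      irreducible := hirr
      unif_cont := hcont
      unif_open := hopen
      unif_surj := hsurj
      unif_iff := hiff
      unif_hol := hhol
      f := f
      piece := piece
      Z := Z
      u := u
      rep := rep
      pts := pts
      rep_spec := hrep
      Z_hol := hZd
      Z_mem := hZm
      f_mk := hfmk
      f_pts := hptsf
      f_rep := hmkrep
      pts_unif := hval
      f_admissible := hadm
      junction := hJunc
      f_injective := hfinj
      f_recip := (hrec Fi τE hcov).1
      cm_recip := (hrec Fi τE hcov).2
      q := q
      q_spec := hQ
      Mρ := Mρ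
      Mρ_kottwitz := fun a v hv b =>
        exists_linear_comm_siegelPeriodMap_charpoly_eq_prod_pow Fr ι₁ (⟨Φ, hΦ.2⟩ : CMType F) hΦ.1 (mOf ι₁ Φ)
          (by simp [mOf]) (by simp [mOf]) (fun φ hφ h h' => by simp [mOf, h, h', hφ]) (fun φ hφ h h' => by simp [mOf, h, h', hφ])
          hδ.1 _ hv (hZm a v hv) (hQ v hv a).1 (fun b t ht => hNρ v hv a b t ht) b
      Mρ_rosati := hR
      ρ₀ := ρ
      Mρ_frame := hfr
      bq_comm_ρ₀ := fun γ b => by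
        rw [MonoidHom.comp_apply, MonoidHom.inl_apply, coe_auxToGspRatV]
        exact (map_intCast_reading_mul_coe_auxRepV_comm Fr ρ hρ ℚ b _).symm
      Z_equivariant := fun a γ hγ v hv v' hv' c hc hγv =>
        exists_siegelLevelGroup_lattice_transport_comm_reading F Fr Φ' ι₁ hg hδ hN hle (fun c => (hrep c).2.2.1) hZm hQ hNρ
          a γ hγ v hv v' hv' c hc hγv }⟩

end StubE123Paid


/-! (★ re-home, size lint: this is PART A of `Lines/…` — the file continues, in the same namespace, in `Theorems/F0P6aPELWitnessE.lean`.) -/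

end Summit.HodgeConjecture.HodgeConjecture.Cruxes.HLiu418.F0P6aPELWitnessE

end
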